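import Summits.CriticalPhenomena.PercolationContinuityZ3.Theorems.PercNearOneGluingAdditiveGluingBlockGoodLeaves
import HarnessLib

/-! # Crux `PercNearOneGluing.AdditiveGluing` (stmt-CriticalPhenomena-4576), stub `stub_goodStep` — the DRIFT-FREE class

Stub-plan prover; lands `--supports stmt-CriticalPhenomena-4576`; no definitions, no named facts.

**`goodStep_of_driftFree`** (registered `stub_goodStepDriftFree_sp`): the inductive step `stub_goodStep` (verbatim hypotheses and
conclusion) holds for every observer `o` such that gluing a block of its low neighbours never re-orders the worst relay:
for `K` = `w` with the star of `o` killed, every minimiser `a₀` of `μ_K(· ↔ b)` over `A` and every block `S` of low neighbours with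
`|S| ≥ 2`, `a₀` still minimises `μ_{K/S}(· ↔ b)` over `A`.  Then the kernel `hker` of `goodStep24_main` is the induction hypothesis
for the glued quadruple `(K/S, A, s₀, b)` (`s₀ ∈ S`; `K/S` has fewer positive-degree vertices than `w`, `driftFree_card_lt`) read through
un-gluing (`blockGood_leaf_ih`, H7, and `blockGrowth_glue_real_*`, H3).  Complement: when gluing DOES re-order the relays, the
designated inequality is the drift theorem `blockGood_cardLeThree` for `A.card ≤ 3` and open beyond.
[cite: KozmaNitzan2024, §3.2 (Thms 4–5 pp. 12–14, Question 7 p. 36)]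
-/

namespace Summit.CriticalPhenomena.PercolationContinuityZ3.Theorems

open MeasureTheory Set
open Literature.Probability.LatticeModels (prodBernoulli)
open Literature.Probability.Percolation (BondConfig openConn openConnIn openGraph openCluster)
open scoped BigOperators

noncomputable section
open Classical

section DriftFree

open Literature.Probability.LatticeModels Literature.Probability.Percolation

variable {n : ℕ}

/-- Killing the star of an observer with a low neighbour and gluing a block of its low neighbours strictly decreases the number of
positive-degree vertices. [folklore] -/
theorem driftFree_card_lt (w : Sym2 (Fin n) → unitInterval) (S : Finset (Fin n)) (o y₀ : Fin n) (hoS : o ∉ S)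
    (hy₀ : (w s(o, y₀) : ℝ) ≠ 0) (hSw : ∀ y ∈ S, w s(o, y) ≠ 0) :
    (Finset.univ.filter (fun v : Fin n => ∃ u : Fin n,
        0 < ((fun e : Sym2 (Fin n) => if (∀ x ∈ e, x ∈ S) ∧ ¬ e.IsDiag then 1 else
          (fun e : Sym2 (Fin n) => if o ∈ e then (0 : unitInterval) else w e) e) s(u, v) : ℝ))).card <
      (Finset.univ.filter (fun v : Fin n => ∃ u : Fin n, 0 < (w s(u, v) : ℝ))).card := by
  refine Finset.card_lt_card (Finset.ssubset_iff_subset_ne.2 ⟨fun v hv => ?_, fun heq => ?_⟩)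
  · simp only [Finset.mem_filter, Finset.mem_univ, true_and] at hv ⊢
    obtain ⟨u, hu⟩ := hv
    by_cases hS : (∀ x ∈ s(u, v), x ∈ S) ∧ ¬ (s(u, v)).IsDiag
    · have hvS : v ∈ S := hS.1 v (Sym2.mem_mk_right u v)
      refine ⟨o, lt_of_le_of_ne (unitInterval.nonneg _) fun h => hSw v hvS (Subtype.ext ?_)⟩
      exact h.symm
    · rw [if_neg hS] at hu
      by_cases hou : o ∈ s(u, v)
      · simp only [hou, if_true] at hu
        simp at hu
      · simp only [hou, if_false] at hu
        exact ⟨u, hu⟩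
  · have ho : o ∈ Finset.univ.filter (fun v : Fin n => ∃ u : Fin n, 0 < (w s(u, v) : ℝ)) := by
      simp only [Finset.mem_filter, Finset.mem_univ, true_and]
      refine ⟨y₀, ?_⟩
      rw [Sym2.eq_swap]
      exact lt_of_le_of_ne (unitInterval.nonneg _) (Ne.symm hy₀)
    rw [← heq] at ho
    simp only [Finset.mem_filter, Finset.mem_univ, true_and] at ho
    obtain ⟨u, hu⟩ := ho
    have hS : ¬ ((∀ x ∈ s(u, o), x ∈ S) ∧ ¬ (s(u, o)).IsDiag) := fun h => hoS (h.1 o (Sym2.mem_mk_right u o))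
    rw [if_neg hS] at hu
    simp only [Sym2.mem_mk_right, if_true] at hu
    simp at hu

/-- **The inductive step `stub_goodStep` for DRIFT-FREE observers.**  See the module docstring.
[cite: KozmaNitzan2024, §3.2 (Thms 4–5 pp. 12–14, Question 7 p. 36)] -/
theorem goodStep_of_driftFree :
    ∀ (n : ℕ) (w : Sym2 (Fin n) → unitInterval) (A : Finset (Fin n)) (o b : Fin n),
      b ∈ A → o ∉ A →
      (∃ y : Fin n, y ∉ A ∧ y ≠ o ∧ (w s(o, y) : ℝ) ≠ 0) →
      (∀ (a₀ : Fin n) (S : Finset (Fin n)), a₀ ∈ A → 2 ≤ S.card → o ∉ S → Disjoint S A →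
        (∀ y ∈ S, w s(o, y) ≠ 0) →
        (∀ a ∈ A, (prodBernoulli (fun e : Sym2 (Fin n) => if o ∈ e then (0 : unitInterval) else w e)).real
            (openConn a₀ b) ≤
          (prodBernoulli (fun e : Sym2 (Fin n) => if o ∈ e then (0 : unitInterval) else w e)).real (openConn a b)) →
        ∀ a ∈ A, (prodBernoulli (fun e : Sym2 (Fin n) =>
            if (∀ x ∈ e, x ∈ S) ∧ ¬ e.IsDiag then 1 else
              (fun e : Sym2 (Fin n) => if o ∈ e then (0 : unitInterval) else w e) e)).real (openConn a₀ b) ≤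
          (prodBernoulli (fun e : Sym2 (Fin n) =>
            if (∀ x ∈ e, x ∈ S) ∧ ¬ e.IsDiag then 1 else
              (fun e : Sym2 (Fin n) => if o ∈ e then (0 : unitInterval) else w e) e)).real (openConn a b)) →
      (∀ w' : Sym2 (Fin n) → unitInterval,
        (Finset.univ.filter (fun v : Fin n => ∃ u : Fin n, 0 < (w' s(u, v) : ℝ))).card
          < (Finset.univ.filter (fun v : Fin n => ∃ u : Fin n, 0 < (w s(u, v) : ℝ))).card →
        ∀ (A' : Finset (Fin n)) (o' b' : Fin n), b' ∈ A' → o' ∉ A' →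
        ∀ (t : ℝ) (sel : Finset (Fin n) → Fin n), (∀ W, sel W ∈ A') →
          (∀ a ∈ A', 1 - t ≤ (prodBernoulli w').real (openConn a b')) →
          (prodBernoulli w').real ((⋃ a ∈ A', openConn o' a) ∩ (openConn o' b')ᶜ)
            + ∑ W ∈ (Finset.univ : Finset (Finset (Fin n))).filter (fun W => o' ∈ W ∧ Disjoint W A'),
                (prodBernoulli w').real {ω : BondConfig (Fin n) | openCluster ω o' = (W : Set (Fin n))}
                  * (prodBernoulli w').real (openConnIn ((W : Set (Fin n))ᶜ) (sel W) b')ᶜ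
            ≤ t) →
      ∀ (t : ℝ) (sel : Finset (Fin n) → Fin n), (∀ W, sel W ∈ A) →
        (∀ a ∈ A, 1 - t ≤ (prodBernoulli w).real (openConn a b)) →
        (prodBernoulli w).real ((⋃ a ∈ A, openConn o a) ∩ (openConn o b)ᶜ)
          + ∑ W ∈ (Finset.univ : Finset (Finset (Fin n))).filter (fun W => o ∈ W ∧ Disjoint W A),
              (prodBernoulli w).real {ω : BondConfig (Fin n) | openCluster ω o = (W : Set (Fin n))}
                * (prodBernoulli w).real (openConnIn ((W : Set (Fin n))ᶜ) (sel W) b)ᶜ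
          ≤ t := by
  intro n w A o b hb ho hlow hfree IH
  obtain ⟨y₀, -, -, hy₀⟩ := id hlow
  refine goodStep24_main n w A o b hb ho hlow IH ?_
  intro S sel a₀ h2 hoS hSA hSw hsel ha₀ hmin _
  set K : Sym2 (Fin n) → unitInterval := fun e => if o ∈ e then (0 : unitInterval) else w e with hK
  obtain ⟨s₀, hs₀⟩ := Finset.card_pos.1 (lt_of_lt_of_le zero_lt_two h2)
  have hs₀A : s₀ ∉ A := Finset.disjoint_left.1 hSA hs₀
  -- the glued minimiser is still `a₀`
  have hmin' := hfree a₀ S ha₀ h2 hoS hSA hSw hmin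
  -- the induction hypothesis for the glued quadruple `(K/S, A, s₀, b)`
  have hgood := IH (fun e : Sym2 (Fin n) => if (∀ x ∈ e, x ∈ S) ∧ ¬ e.IsDiag then 1 else K e)
    (driftFree_card_lt w S o y₀ hoS hy₀ hSw) A s₀ b hb hs₀A
  -- H7 in un-glued form, then re-glue with H3
  have h7 := blockGood_leaf_ih K A S b a₀ s₀ (fun W' => sel (insert o W')) hs₀ hb (fun W' => hsel _) hmin' hgood
  rw [← blockGrowth_glue_real_openConn, ← blockGrowth_glue_real_iUnion K S b] at h7
  simp only [← blockGrowth_glue_real_pocket K S] at h7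
  exact h7

end DriftFree

open Literature.Probability.LatticeModels Literature.Probability.Percolation in
/-- Registered helper stub `stub_goodStepDriftFree_sp` (stub-plan prover): `stub_goodStep` for DRIFT-FREE observers — gluing a block of
low neighbours never re-orders the worst relay (= `goodStep_of_driftFree`). [cite: KozmaNitzan2024, §3.2 (Thms 4–5 pp. 12–14)] -/
theorem stub_goodStepDriftFree_sp : ∀ (n : ℕ) (w : Sym2 (Fin n) → unitInterval) (A : Finset (Fin n)) (o b : Fin n), b ∈ A → o ∉ A → (∃ y : Fin n, y ∉ A ∧ y ≠ o ∧ (w s(o, y) : ℝ) ≠ 0) → (∀ (a₀ : Fin n) (S : Finset (Fin n)), a₀ ∈ A → 2 ≤ S.card → o ∉ S → Disjoint S A → (∀ y ∈ S, w s(o, y) ≠ 0) → (∀ a ∈ A, (prodBernoulli (fun e : Sym2 (Fin n) => if o ∈ e then (0 : unitInterval) else w e)).real (openConn a₀ b) ≤ (prodBernoulli (fun e : Sym2 (Fin n) => if o ∈ e then (0 : unitInterval) else w e)).real (openConn a b)) → ∀ a ∈ A, (prodBernoulli (fun e : Sym2 (Fin n) => if (∀ x ∈ e, x ∈ S) ∧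 ¬ e.IsDiag then 1 else (fun e : Sym2 (Fin n) => if o ∈ e then (0 : unitInterval) else w e) e)).real (openConn a₀ b) ≤ (prodBernoulli (fun e : Sym2 (Fin n) => if (∀ x ∈ e, x ∈ S) ∧ ¬ e.IsDiag then 1 else (fun e : Sym2 (Fin n) => if o ∈ e then (0 : unitInterval) else w e) e)).real (openConn a b)) → (∀ w' : Sym2 (Fin n) → unitInterval, (Finset.univ.filter (fun v : Fin n => ∃ u : Fin n, 0 < (w' s(u, v) : ℝ))).card < (Finset.univ.filter (fun v : Fin n => ∃ u : Fin n, 0 < (w s(u, v) : ℝ))).card → ∀ (A' : Finset (Fin n)) (o' b' : Fin n), b' ∈ A' → o' ∉ A' → ∀ (t : ℝ) (sel : Finset (Fin n) → Fin n), (∀ W, sel W ∈ A') → (∀ a ∈ A', 1 - t ≤ (prodBernoulli w').real (openConn a b')) → (prodBernoulli w').real ((⋃ a ∈ A', openConn o' a) ∩ (openConn o' b')ᶜ) + ∑ W ∈ (Finset.univ : Finset (Finset (Fin n))).filter (fun W => o' ∈ W ∧ Disjoint W A'), (prodBernoulli w').real {ω : BondConfig (Fin n) | openCluster ω o' = (W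 : Set (Fin n))} * (prodBernoulli w').real (openConnIn ((W : Set (Fin n))ᶜ) (sel W) b')ᶜ ≤ t) → ∀ (t : ℝ) (sel : Finset (Fin n) → Fin n), (∀ W, sel W ∈ A) → (∀ a ∈ A, 1 - t ≤ (prodBernoulli w).real (openConn a b)) → (prodBernoulli w).real ((⋃ a ∈ A, openConn o a) ∩ (openConn o b)ᶜ) + ∑ W ∈ (Finset.univ : Finset (Finset (Fin n))).filter (fun W => o ∈ W ∧ Disjoint W A), (prodBernoulli w).real {ω : BondConfig (Fin n) | openCluster ω o = (W : Set (Fin n))} * (prodBernoulli w).real (openConnIn ((W : Set (Fin n))ᶜ) (sel W) b)ᶜ ≤ t :=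
  goodStep_of_driftFree

end

end Summit.CriticalPhenomena.PercolationContinuityZ3.Theorems
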